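import Summits.CriticalPhenomena.PercolationContinuityZ3.Theorems.PercNearOneGluingNoHeavyLowerTailKnQuestion8CoefficientwiseOffClusterGen
import Summits.CriticalPhenomena.PercolationContinuityZ3.Theorems.PercNearOneGluingNoHeavyLowerTailKnQuestion8CoefficientwiseParallelGlue
import Summits.CriticalPhenomena.PercolationContinuityZ3.Theorems.PercNearOneGluingNoHeavyLowerTailDualBHKBlock
import HarnessLib

/-!
# CONJECTURE NO-CORE: PARALLEL composition with a TAME piece — prim-lf-2 gen 55

Support file (`--supports stmt-CriticalPhenomena-4575`, closed), prover `prim-lf-2` (gen 55).  No definitions, no named facts, no sorries; standard axioms.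
Memo `prim-lf-2/CW-TWOSOURCESYM-gen55.md` §3.6; companions `…CoefficientwiseNoCoreSeries.lean` (series), `…CoefficientwiseNoCoreDecoration.lean` (decorations),
`…CoefficientwiseNoCoreBase.lean` (base members), `…CoefficientwiseOffClusterGen.lean` (two-function off-cluster lemma with a general complement side), `…CoefficientwiseParallelGlue.lean`.

`(E; x, z) ∈ 𝒩` iff `0 ≤ Σ_{s ⊆ E : ¬(z ∈ C_x(s) ∧ z ∈ C_x(E∖s))} (f(C_x s) − f(C_x(E∖s)))·(g(C_x s) − g(C_x(E∖s)))` for all monotone `f, g` (CONJECTURE NO-CORE, gen 46).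
Two edge sets `E₁, E₂` whose edges share only the two terminals `x, z` are glued IN PARALLEL; write `K_i = C_x`, `Z_i = C_z` on the pieces.
Gluing lemma (`…CoefficientwiseParallelGlue.lean`): `C_x(s₁ ∪ s₂) = K₁ ∪ K₂ ∪ [z ∈ K₁ ∪ K₂]·(Z₁ ∪ Z₂)`.
* `Coefficientwise.noCore_parallel_tame` — **THEOREM**: if `(E₁; x, z) ∈ 𝒩` and the piece `E₂` is TAME, i.e.
  (Ta) for every colouring `s₂ ⊆ E₂` joining `z` to `x` in red but not in blue, `K₂(E₂∖s₂) ⊆ K₂(s₂)`, and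
  (Tb) for every colouring of `E₂` joining `z` to `x` in neither colour and every `X : Set V`, the sets `X ∪ [z∈X]Z₂(s₂) ∪ K₂(s₂)` and `X ∪ [z∈X]Z₂(E₂∖s₂) ∪ K₂(E₂∖s₂)` are
  `⊆`-comparable,
  then `(E₁ ∪ E₂; x, z) ∈ 𝒩`.  Tame pieces include the `x–z` paths of length 2 and 3, and 176 of the 728 two-terminal pieces on 5 vertices (prim-lf-2 gen 55, code/gen55/c/tame.c); by the
  block analysis of the memo no hypothesis beyond tameness is needed on `E₂` (its own NO-CORE property is not used).
Proof.  Split by the `E₂`-statistic `(z ∈ K₂ s₂, z ∈ K₂(E₂∖s₂))`: `(1,1)` contributes nothing (`z` is in the core); `(1,0)`: the admissible `s₁` are those with `z ∉ K₁(E₁∖s₁)`, the clusters are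
`K₁ s₁ ∪ Z₁ s₁ ∪ K₂ s₂` and `K₁(E₁∖s₁) ∪ K₂(E₂∖s₂)`, and after the swap on `E₁` this is `offCluster_twoColouring_nonneg_gen_sub` (avoided set `{z}`, complement side
`t ↦ f(K₁ t ∪ Z₁ t ∪ K₂ s₂) ≥ f(K₁ t ∪ K₂(E₂∖s₂))` by (Ta)); `(0,1)`: mirror; `(0,0)` (the wall colourings of `E₂`, a complement-invariant set): the admissible `s₁` form the NO-CORE event of `E₁`,
and pairing `s₂` with `E₂ ∖ s₂` gives, by the identity `(a−b′)(c−d′)+(b−a′)(d−c′) = (a−a′)(d−d′)+(b−b′)(c−c′)+(a−b)(c−d)+(a′−b′)(c′−d′)`, two NO-CORE sums of `E₁` with glued monotone functions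
plus terms `(f(A)−f(B))(g(A)−g(B))` with `A, B` the two comparable sets of (Tb) — nonnegative.
[cite: KozmaNitzan2024, Questions 8–9 (§5.5 p. 36) (context: the Question-8 pocket covariance programme)]
-/

namespace Summit.CriticalPhenomena.PercolationContinuityZ3.Theorems

open Finset Literature.Probability.Percolation

namespace Coefficientwise

variable {ι V : Type*} [Fintype ι] [DecidableEq ι]

omit [Fintype ι] in
open Classical in
/-- **Parallel composition with a tame piece.**  Let `E₁, E₂ ⊆ ι` be disjoint edge sets of a finite multigraph whose edges can only share the two terminals `x ≠ z`.  If `(E₁; x, z)` satisfies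
NO-CORE for all monotone `φ, ψ`, and `E₂` is TAME — (Ta) `C_x(E₂∖s₂) ⊆ C_x(s₂)` whenever `s₂ ⊆ E₂` joins `z` to `x` in red but not in blue, and (Tb) for every `s₂ ⊆ E₂` joining `z` to `x` in
neither colour and every `X : Set V` the two sets `X ∪ [z∈X]·C_z(s₂) ∪ C_x(s₂)` and `X ∪ [z∈X]·C_z(E₂∖s₂) ∪ C_x(E₂∖s₂)` are `⊆`-comparable — then `(E₁ ∪ E₂; x, z)` satisfies NO-CORE:
`0 ≤ Σ_{s ⊆ E₁∪E₂ : ¬(z ∈ C_x s ∧ z ∈ C_x(E∖s))} (f(C_x s) − f(C_x(E∖s)))(g(C_x s) − g(C_x(E∖s)))` for all monotone `f, g`.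
[cite: KozmaNitzan2024, Questions 8–9 (§5.5 p. 36) (context)] -/
theorem noCore_parallel_tame (ends : ι → Sym2 V) {E₁ E₂ : Finset ι} (hE : Disjoint E₁ E₂) {x z : V}
    (hsep : ∀ e ∈ E₁, ∀ e' ∈ E₂, ∀ w : V, w ∈ ends e → w ∈ ends e' → w = x ∨ w = z)
    (h₁ : ∀ φ ψ : Set V → ℝ, Monotone φ → Monotone ψ →
      0 ≤ ∑ s ∈ E₁.powerset.filter (fun s : Finset ι => ¬ (z ∈ openCluster (ends '' (↑s : Set ι)) x ∧
            z ∈ openCluster (ends '' (↑(E₁ \ s) : Set ι)) x)),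
        (φ (openCluster (ends '' (↑s : Set ι)) x) - φ (openCluster (ends '' (↑(E₁ \ s) : Set ι)) x)) *
          (ψ (openCluster (ends '' (↑s : Set ι)) x) - ψ (openCluster (ends '' (↑(E₁ \ s) : Set ι)) x)))
    (hTa : ∀ s₂, s₂ ⊆ E₂ → z ∈ openCluster (ends '' (↑s₂ : Set ι)) x → z ∉ openCluster (ends '' (↑(E₂ \ s₂) : Set ι)) x →
      openCluster (ends '' (↑(E₂ \ s₂) : Set ι)) x ⊆ openCluster (ends '' (↑s₂ : Set ι)) x)
    (hTb : ∀ s₂, s₂ ⊆ E₂ → z ∉ openCluster (ends '' (↑s₂ : Set ι)) x → z ∉ openCluster (ends '' (↑(E₂ \ s₂) : Set ι)) x → ∀ X : Set V,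
      (X ∪ {w | z ∈ X ∧ w ∈ openCluster (ends '' (↑s₂ : Set ι)) z} ∪ openCluster (ends '' (↑s₂ : Set ι)) x ⊆
          X ∪ {w | z ∈ X ∧ w ∈ openCluster (ends '' (↑(E₂ \ s₂) : Set ι)) z} ∪ openCluster (ends '' (↑(E₂ \ s₂) : Set ι)) x) ∨
        (X ∪ {w | z ∈ X ∧ w ∈ openCluster (ends '' (↑(E₂ \ s₂) : Set ι)) z} ∪ openCluster (ends '' (↑(E₂ \ s₂) : Set ι)) x ⊆
          X ∪ {w | z ∈ X ∧ w ∈ openCluster (ends '' (↑s₂ : Set ι)) z} ∪ openCluster (ends '' (↑s₂ : Set ι)) x))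
    (f g : Set V → ℝ) (hf : Monotone f) (hg : Monotone g) :
    0 ≤ ∑ s ∈ (E₁ ∪ E₂).powerset.filter (fun s : Finset ι => ¬ (z ∈ openCluster (ends '' (↑s : Set ι)) x ∧
          z ∈ openCluster (ends '' (↑((E₁ ∪ E₂) \ s) : Set ι)) x)),
      (f (openCluster (ends '' (↑s : Set ι)) x) - f (openCluster (ends '' (↑((E₁ ∪ E₂) \ s) : Set ι)) x)) *
        (g (openCluster (ends '' (↑s : Set ι)) x) - g (openCluster (ends '' (↑((E₁ ∪ E₂) \ s) : Set ι)) x)) := by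
  -- notation
  set K : Finset ι → Set V := fun s => openCluster (ends '' (↑s : Set ι)) x with hK
  set Kz : Finset ι → Set V := fun s => openCluster (ends '' (↑s : Set ι)) z with hKz
  set Pg : Finset ι → Finset ι → Set V := fun s₁ s₂ =>
    K s₁ ∪ K s₂ ∪ {w | (z ∈ K s₁ ∨ z ∈ K s₂) ∧ (w ∈ Kz s₁ ∨ w ∈ Kz s₂)} with hPg
  set gl : Finset ι → Set V → Set V := fun s₂ X => X ∪ {w | z ∈ X ∧ w ∈ Kz s₂} ∪ K s₂ with hgl
  change 0 ≤ ∑ s ∈ (E₁ ∪ E₂).powerset.filter (fun s => ¬ (z ∈ K s ∧ z ∈ K ((E₁ ∪ E₂) \ s))),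
      (f (K s) - f (K ((E₁ ∪ E₂) \ s))) * (g (K s) - g (K ((E₁ ∪ E₂) \ s)))
  have h₁' : ∀ φ ψ : Set V → ℝ, Monotone φ → Monotone ψ →
      0 ≤ ∑ s ∈ E₁.powerset.filter (fun s => ¬ (z ∈ K s ∧ z ∈ K (E₁ \ s))),
        (φ (K s) - φ (K (E₁ \ s))) * (ψ (K s) - ψ (K (E₁ \ s))) := h₁
  have hTa' : ∀ s₂, s₂ ⊆ E₂ → z ∈ K s₂ → z ∉ K (E₂ \ s₂) → K (E₂ \ s₂) ⊆ K s₂ := hTa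
  have hTb' : ∀ s₂, s₂ ⊆ E₂ → z ∉ K s₂ → z ∉ K (E₂ \ s₂) → ∀ X : Set V, gl s₂ X ⊆ gl (E₂ \ s₂) X ∨ gl (E₂ \ s₂) X ⊆ gl s₂ X := hTb
  -- basic facts
  have hKmono : ∀ {s t : Finset ι}, s ⊆ t → K s ⊆ K t := fun hst => openCluster_image_mono ends hst x
  have hKzmono : ∀ {s t : Finset ι}, s ⊆ t → Kz s ⊆ Kz t := fun hst => openCluster_image_mono ends hst z
  have mem_Pg : ∀ (s₁ s₂ : Finset ι) (w : V), w ∈ Pg s₁ s₂ ↔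
      (w ∈ K s₁ ∨ w ∈ K s₂ ∨ ((z ∈ K s₁ ∨ z ∈ K s₂) ∧ (w ∈ Kz s₁ ∨ w ∈ Kz s₂))) := by
    intro s₁ s₂ w
    simp only [hPg, Set.mem_union, Set.mem_setOf_eq]
    tauto
  have mem_gl : ∀ (s₂ : Finset ι) (X : Set V) (w : V), w ∈ gl s₂ X ↔ (w ∈ X ∨ (z ∈ X ∧ w ∈ Kz s₂) ∨ w ∈ K s₂) := by
    intro s₂ X w
    simp only [hgl, Set.mem_union, Set.mem_setOf_eq]
    tauto
  have gl_mono : ∀ (s₂ : Finset ι) {X X' : Set V}, X ⊆ X' → gl s₂ X ⊆ gl s₂ X' := by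
    intro s₂ X X' h w hw
    rw [mem_gl] at hw ⊢
    rcases hw with hw | ⟨hz, hw⟩ | hw
    · exact Or.inl (h hw)
    · exact Or.inr (Or.inl ⟨h hz, hw⟩)
    · exact Or.inr (Or.inr hw)
  have Kz_eq_K : ∀ s : Finset ι, z ∈ K s → Kz s = K s := by
    intro s hz
    ext v
    change (openGraph (ends '' (↑s : Set ι))).Reachable z v ↔ (openGraph (ends '' (↑s : Set ι))).Reachable x v
    have hxz : (openGraph (ends '' (↑s : Set ι))).Reachable x z := hz
    exact ⟨fun h => hxz.trans h, fun h => hxz.symm.trans h⟩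
  -- the glued cluster when the `E₂`-side does not join `z` to `x`
  have Pga : ∀ s₁ s₂ : Finset ι, z ∉ K s₂ → Pg s₁ s₂ = gl s₂ (K s₁) := by
    intro s₁ s₂ hz2
    ext w
    rw [mem_Pg, mem_gl]
    by_cases hz1 : z ∈ K s₁
    · have e := Kz_eq_K s₁ hz1
      rw [e]
      tauto
    · tauto
  -- the glued cluster when the `E₂`-side joins `z` to `x`
  have Pgb : ∀ s₁ s₂ : Finset ι, z ∈ K s₂ → Pg s₁ s₂ = K s₁ ∪ Kz s₁ ∪ K s₂ := by
    intro s₁ s₂ hz2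
    ext w
    rw [mem_Pg, Set.mem_union, Set.mem_union]
    have e := Kz_eq_K s₂ hz2
    rw [e]
    by_cases hz1 : z ∈ K s₁
    · have e1 := Kz_eq_K s₁ hz1
      rw [e1]
      tauto
    · constructor
      · rintro (h | h | ⟨_, h | h⟩)
        · exact Or.inl (Or.inl h)
        · exact Or.inr h
        · exact Or.inl (Or.inr h)
        · exact Or.inr h
      · rintro ((h | h) | h)
        · exact Or.inl h
        · exact Or.inr (Or.inr ⟨Or.inr hz2, Or.inl h⟩)
        · exact Or.inr (Or.inl h)
  have z_Pg : ∀ s₁ s₂ : Finset ι, z ∈ Pg s₁ s₂ ↔ (z ∈ K s₁ ∨ z ∈ K s₂) := by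
    intro s₁ s₂
    rw [mem_Pg]
    constructor
    · rintro (h | h | ⟨h, _⟩)
      · exact Or.inl h
      · exact Or.inr h
      · exact h
    · rintro (h | h)
      · exact Or.inl h
      · exact Or.inr (Or.inl h)
  -- cluster decomposition under parallel gluing
  have decomp : ∀ s₁ s₂ : Finset ι, s₁ ⊆ E₁ → s₂ ⊆ E₂ → K (s₁ ∪ s₂) = Pg s₁ s₂ := by
    intro s₁ s₂ hs₁ hs₂
    ext w
    rw [mem_Pg]
    exact mem_openCluster_union_parallel_gen ends
      (fun e he e' he' w' hw hw' => hsep e (hs₁ he) e' (hs₂ he') w' hw hw') w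
  -- the sum over colourings of `E₁ ∪ E₂` as a double sum, each summand in glued form
  simp only [Finset.sum_filter]
  rw [DualBHK.sum_powerset_union hE, Finset.sum_comm]
  have hsummand : ∀ s₂ ∈ E₂.powerset, ∀ s₁ ∈ E₁.powerset,
      (if ¬ (z ∈ K (s₁ ∪ s₂) ∧ z ∈ K ((E₁ ∪ E₂) \ (s₁ ∪ s₂)))
        then (f (K (s₁ ∪ s₂)) - f (K ((E₁ ∪ E₂) \ (s₁ ∪ s₂)))) *
          (g (K (s₁ ∪ s₂)) - g (K ((E₁ ∪ E₂) \ (s₁ ∪ s₂)))) else 0)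
      = (if ¬ ((z ∈ K s₁ ∨ z ∈ K s₂) ∧ (z ∈ K (E₁ \ s₁) ∨ z ∈ K (E₂ \ s₂)))
        then (f (Pg s₁ s₂) - f (Pg (E₁ \ s₁) (E₂ \ s₂))) * (g (Pg s₁ s₂) - g (Pg (E₁ \ s₁) (E₂ \ s₂))) else 0) := by
    intro s₂ hs₂ s₁ hs₁
    have hs₁' := Finset.mem_powerset.mp hs₁
    have hs₂' := Finset.mem_powerset.mp hs₂
    have hK12 : K (s₁ ∪ s₂) = Pg s₁ s₂ := decomp s₁ s₂ hs₁' hs₂'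
    have hKc : K ((E₁ ∪ E₂) \ (s₁ ∪ s₂)) = Pg (E₁ \ s₁) (E₂ \ s₂) := by
      rw [union_sdiff_union_of_subset hE hs₁' hs₂']
      exact decomp (E₁ \ s₁) (E₂ \ s₂) Finset.sdiff_subset Finset.sdiff_subset
    have hcond : (¬ (z ∈ K (s₁ ∪ s₂) ∧ z ∈ K ((E₁ ∪ E₂) \ (s₁ ∪ s₂)))) ↔
        (¬ ((z ∈ K s₁ ∨ z ∈ K s₂) ∧ (z ∈ K (E₁ \ s₁) ∨ z ∈ K (E₂ \ s₂)))) := by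
      rw [hK12, hKc]
      exact not_congr (and_congr (z_Pg _ _) (z_Pg _ _))
    by_cases hc : ¬ (z ∈ K (s₁ ∪ s₂) ∧ z ∈ K ((E₁ ∪ E₂) \ (s₁ ∪ s₂)))
    · rw [if_pos hc, if_pos (hcond.mp hc), hK12, hKc]
    · rw [if_neg hc, if_neg (fun h => hc (hcond.mpr h))]
  rw [Finset.sum_congr rfl fun s₂ hs₂ => Finset.sum_congr rfl fun s₁ hs₁ => hsummand s₂ hs₂ s₁ hs₁]
  -- the inner sum, as a function of the colouring `s₂` of `E₂`
  set I : Finset ι → ℝ := fun s₂ => ∑ s₁ ∈ E₁.powerset,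
      (if ¬ ((z ∈ K s₁ ∨ z ∈ K s₂) ∧ (z ∈ K (E₁ \ s₁) ∨ z ∈ K (E₂ \ s₂)))
        then (f (Pg s₁ s₂) - f (Pg (E₁ \ s₁) (E₂ \ s₂))) * (g (Pg s₁ s₂) - g (Pg (E₁ \ s₁) (E₂ \ s₂))) else 0) with hI
  -- block (1,0): `s₂` joins `z` to `x` in red, not in blue
  have block10 : ∀ s₂, s₂ ⊆ E₂ → z ∈ K s₂ → z ∉ K (E₂ \ s₂) → 0 ≤ I s₂ := by
    intro s₂ hs₂ hz1 hz2
    have hsub : K (E₂ \ s₂) ⊆ K s₂ := hTa' s₂ hs₂ hz1 hz2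
    -- the complement-side functions
    set φ : Set V → ℝ := fun X => f (X ∪ K (E₂ \ s₂)) with hφ
    set γ : Set V → ℝ := fun X => g (X ∪ K (E₂ \ s₂)) with hγ
    set F' : Finset ι → ℝ := fun t => f (K t ∪ Kz t ∪ K s₂) with hF'
    set G' : Finset ι → ℝ := fun t => g (K t ∪ Kz t ∪ K s₂) with hG'
    have hφm : Monotone φ := fun X X' h => hf (Set.union_subset_union_left _ h)
    have hγm : Monotone γ := fun X X' h => hg (Set.union_subset_union_left _ h)
    have hF'm : Monotone F' := fun t t' h =>
      hf (Set.union_subset_union (Set.union_subset_union (hKmono h) (hKzmono h)) le_rfl)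
    have hG'm : Monotone G' := fun t t' h =>
      hg (Set.union_subset_union (Set.union_subset_union (hKmono h) (hKzmono h)) le_rfl)
    have hdom : ∀ t : Finset ι, K t ∪ K (E₂ \ s₂) ⊆ K t ∪ Kz t ∪ K s₂ := by
      intro t w hw
      rcases hw with hw | hw
      · exact Or.inl (Or.inl hw)
      · exact Or.inr (hsub hw)
    have key := offCluster_twoColouring_nonneg_gen_sub ends E₁ x ({z} : Set V) φ γ F' G' hφm hγm hF'm hG'm
      (fun t _ => hf (hdom t)) (fun t _ => hg (hdom t))
    rw [Finset.sum_filter] at key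
    -- reindex the block by the colour swap on `E₁`
    have e : I s₂ = ∑ t ∈ E₁.powerset, (if z ∉ K t then (φ (K t) - F' (E₁ \ t)) * (γ (K t) - G' (E₁ \ t)) else 0) := by
      simp only [hI]
      rw [← sum_powerset_sdiff E₁ (fun t => if z ∉ K t then (φ (K t) - F' (E₁ \ t)) * (γ (K t) - G' (E₁ \ t)) else 0)]
      refine Finset.sum_congr rfl fun s₁ hs₁ => ?_
      have hss : E₁ \ (E₁ \ s₁) = s₁ := Finset.sdiff_sdiff_eq_self (Finset.mem_powerset.mp hs₁)
      simp only [hss]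
      by_cases hc : z ∈ K (E₁ \ s₁)
      · rw [if_neg (fun h => h ⟨Or.inr hz1, Or.inl hc⟩), if_neg (fun h => h hc)]
      · rw [if_pos (fun h => by rcases h.2 with h2 | h2; exact hc h2; exact hz2 h2), if_pos hc,
          Pgb s₁ s₂ hz1, Pga (E₁ \ s₁) (E₂ \ s₂) hz2]
        have hglc : gl (E₂ \ s₂) (K (E₁ \ s₁)) = K (E₁ \ s₁) ∪ K (E₂ \ s₂) := by
          ext w; rw [mem_gl, Set.mem_union]
          constructor
          · rintro (h | ⟨hz, _⟩ | h)
            · exact Or.inl h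
            · exact absurd hz hc
            · exact Or.inr h
          · rintro (h | h)
            · exact Or.inl h
            · exact Or.inr (Or.inr h)
        rw [hglc]
        simp only [hφ, hγ, hF', hG']
        ring
    rw [e]
    refine key.trans_eq (Finset.sum_congr rfl fun t _ => ?_)
    refine if_congr ⟨fun h => h z rfl, fun h a ha => ?_⟩ rfl rfl
    rw [Set.mem_singleton_iff] at ha
    rw [ha]; exact h
  -- block (0,1): `s₂` joins `z` to `x` in blue, not in red
  have block01 : ∀ s₂, s₂ ⊆ E₂ → z ∉ K s₂ → z ∈ K (E₂ \ s₂) → 0 ≤ I s₂ := by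
    intro s₂ hs₂ hz1 hz2
    have hss : E₂ \ (E₂ \ s₂) = s₂ := Finset.sdiff_sdiff_eq_self hs₂
    have hsub : K s₂ ⊆ K (E₂ \ s₂) := by
      have := hTa' (E₂ \ s₂) Finset.sdiff_subset hz2 (by rw [hss]; exact hz1)
      rw [hss] at this
      exact this
    set φ : Set V → ℝ := fun X => f (X ∪ K s₂) with hφ
    set γ : Set V → ℝ := fun X => g (X ∪ K s₂) with hγ
    set F' : Finset ι → ℝ := fun t => f (K t ∪ Kz t ∪ K (E₂ \ s₂)) with hF'
    set G' : Finset ι → ℝ := fun t => g (K t ∪ Kz t ∪ K (E₂ \ s₂)) with hG'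
    have hφm : Monotone φ := fun X X' h => hf (Set.union_subset_union_left _ h)
    have hγm : Monotone γ := fun X X' h => hg (Set.union_subset_union_left _ h)
    have hF'm : Monotone F' := fun t t' h =>
      hf (Set.union_subset_union (Set.union_subset_union (hKmono h) (hKzmono h)) le_rfl)
    have hG'm : Monotone G' := fun t t' h =>
      hg (Set.union_subset_union (Set.union_subset_union (hKmono h) (hKzmono h)) le_rfl)
    have hdom : ∀ t : Finset ι, K t ∪ K s₂ ⊆ K t ∪ Kz t ∪ K (E₂ \ s₂) := by
      intro t w hw
      rcases hw with hw | hw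
      · exact Or.inl (Or.inl hw)
      · exact Or.inr (hsub hw)
    have key := offCluster_twoColouring_nonneg_gen_sub ends E₁ x ({z} : Set V) φ γ F' G' hφm hγm hF'm hG'm
      (fun t _ => hf (hdom t)) (fun t _ => hg (hdom t))
    rw [Finset.sum_filter] at key
    have e : I s₂ = ∑ t ∈ E₁.powerset, (if z ∉ K t then (φ (K t) - F' (E₁ \ t)) * (γ (K t) - G' (E₁ \ t)) else 0) := by
      simp only [hI]
      refine Finset.sum_congr rfl fun s₁ _ => ?_
      by_cases hc : z ∈ K s₁
      · rw [if_neg (fun h => h ⟨Or.inl hc, Or.inr hz2⟩), if_neg (fun h => h hc)]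
      · rw [if_pos (fun h => by rcases h.1 with h1 | h1; exact hc h1; exact hz1 h1), if_pos hc,
          Pga s₁ s₂ hz1, Pgb (E₁ \ s₁) (E₂ \ s₂) hz2]
        have hglc : gl s₂ (K s₁) = K s₁ ∪ K s₂ := by
          ext w; rw [mem_gl, Set.mem_union]
          constructor
          · rintro (h | ⟨hz, _⟩ | h)
            · exact Or.inl h
            · exact absurd hz hc
            · exact Or.inr h
          · rintro (h | h)
            · exact Or.inl h
            · exact Or.inr (Or.inr h)
        rw [hglc]
    rw [e]
    refine key.trans_eq (Finset.sum_congr rfl fun t _ => ?_)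
    refine if_congr ⟨fun h => h z rfl, fun h a ha => ?_⟩ rfl rfl
    rw [Set.mem_singleton_iff] at ha
    rw [ha]; exact h
  -- block (1,1): nothing is admissible
  have block11 : ∀ s₂, z ∈ K s₂ → z ∈ K (E₂ \ s₂) → I s₂ = 0 := by
    intro s₂ hz1 hz2
    simp only [hI]
    refine Finset.sum_eq_zero fun s₁ _ => ?_
    rw [if_neg (fun h => h ⟨Or.inr hz1, Or.inr hz2⟩)]
  -- block (0,0): the pairing `s₂ ↔ E₂ \ s₂`
  have block00 : ∀ s₂, s₂ ⊆ E₂ → z ∉ K s₂ → z ∉ K (E₂ \ s₂) → 0 ≤ I s₂ + I (E₂ \ s₂) := by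
    intro s₂ hs₂ hz1 hz2
    have hss : E₂ \ (E₂ \ s₂) = s₂ := Finset.sdiff_sdiff_eq_self hs₂
    -- the glued monotone functions
    have mR : ∀ (φ : Set V → ℝ), Monotone φ → Monotone (fun X => φ (gl s₂ X)) := fun φ hφ X X' h => hφ (gl_mono s₂ h)
    have mB : ∀ (φ : Set V → ℝ), Monotone φ → Monotone (fun X => φ (gl (E₂ \ s₂) X)) := fun φ hφ X X' h => hφ (gl_mono (E₂ \ s₂) h)
    have hA := h₁' (fun X => f (gl s₂ X)) (fun X => g (gl (E₂ \ s₂) X)) (mR f hf) (mB g hg)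
    have hB := h₁' (fun X => f (gl (E₂ \ s₂) X)) (fun X => g (gl s₂ X)) (mB f hf) (mR g hg)
    rw [Finset.sum_filter] at hA hB
    -- the comparable-sets terms
    have hC : 0 ≤ ∑ s₁ ∈ E₁.powerset, (if ¬ (z ∈ K s₁ ∧ z ∈ K (E₁ \ s₁)) then
        ((f (gl s₂ (K s₁)) - f (gl (E₂ \ s₂) (K s₁))) * (g (gl s₂ (K s₁)) - g (gl (E₂ \ s₂) (K s₁))) +
         (f (gl s₂ (K (E₁ \ s₁))) - f (gl (E₂ \ s₂) (K (E₁ \ s₁)))) * (g (gl s₂ (K (E₁ \ s₁))) - g (gl (E₂ \ s₂) (K (E₁ \ s₁))))) else 0) := by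
      have sq : ∀ X : Set V, 0 ≤ (f (gl s₂ X) - f (gl (E₂ \ s₂) X)) * (g (gl s₂ X) - g (gl (E₂ \ s₂) X)) := by
        intro X
        rcases hTb' s₂ hs₂ hz1 hz2 X with h | h
        · exact mul_nonneg_of_nonpos_of_nonpos (by linarith [hf h]) (by linarith [hg h])
        · exact mul_nonneg (by linarith [hf h]) (by linarith [hg h])
      refine Finset.sum_nonneg fun s₁ _ => ?_
      by_cases hc : (z ∈ K s₁ ∧ z ∈ K (E₁ \ s₁))
      · rw [if_neg (fun h => h hc)]
      · rw [if_pos hc]; exact add_nonneg (sq _) (sq _)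
    -- the pointwise identity
    have hpt : ∀ s₁ ∈ E₁.powerset,
        (if ¬ ((z ∈ K s₁ ∨ z ∈ K s₂) ∧ (z ∈ K (E₁ \ s₁) ∨ z ∈ K (E₂ \ s₂)))
          then (f (Pg s₁ s₂) - f (Pg (E₁ \ s₁) (E₂ \ s₂))) * (g (Pg s₁ s₂) - g (Pg (E₁ \ s₁) (E₂ \ s₂))) else 0) +
        (if ¬ ((z ∈ K s₁ ∨ z ∈ K (E₂ \ s₂)) ∧ (z ∈ K (E₁ \ s₁) ∨ z ∈ K (E₂ \ (E₂ \ s₂))))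
          then (f (Pg s₁ (E₂ \ s₂)) - f (Pg (E₁ \ s₁) (E₂ \ (E₂ \ s₂)))) * (g (Pg s₁ (E₂ \ s₂)) - g (Pg (E₁ \ s₁) (E₂ \ (E₂ \ s₂)))) else 0)
        = (if ¬ (z ∈ K s₁ ∧ z ∈ K (E₁ \ s₁)) then
            (f (gl s₂ (K s₁)) - f (gl s₂ (K (E₁ \ s₁)))) * (g (gl (E₂ \ s₂) (K s₁)) - g (gl (E₂ \ s₂) (K (E₁ \ s₁)))) else 0) +
          (if ¬ (z ∈ K s₁ ∧ z ∈ K (E₁ \ s₁)) then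
            (f (gl (E₂ \ s₂) (K s₁)) - f (gl (E₂ \ s₂) (K (E₁ \ s₁)))) * (g (gl s₂ (K s₁)) - g (gl s₂ (K (E₁ \ s₁)))) else 0) +
          (if ¬ (z ∈ K s₁ ∧ z ∈ K (E₁ \ s₁)) then
            ((f (gl s₂ (K s₁)) - f (gl (E₂ \ s₂) (K s₁))) * (g (gl s₂ (K s₁)) - g (gl (E₂ \ s₂) (K s₁))) +
             (f (gl s₂ (K (E₁ \ s₁))) - f (gl (E₂ \ s₂) (K (E₁ \ s₁)))) * (g (gl s₂ (K (E₁ \ s₁))) - g (gl (E₂ \ s₂) (K (E₁ \ s₁))))) else 0) := by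
      intro s₁ _
      rw [hss]
      by_cases hc : (z ∈ K s₁ ∧ z ∈ K (E₁ \ s₁))
      · rw [if_neg (fun h => h ⟨Or.inl hc.1, Or.inl hc.2⟩), if_neg (fun h => h ⟨Or.inl hc.1, Or.inl hc.2⟩),
          if_neg (fun h => h hc), if_neg (fun h => h hc), if_neg (fun h => h hc)]
        ring
      · have c1 : ¬ ((z ∈ K s₁ ∨ z ∈ K s₂) ∧ (z ∈ K (E₁ \ s₁) ∨ z ∈ K (E₂ \ s₂))) := by
          rintro ⟨h1 | h1, h2 | h2⟩
          · exact hc ⟨h1, h2⟩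
          · exact hz2 h2
          · exact hz1 h1
          · exact hz1 h1
        have c2 : ¬ ((z ∈ K s₁ ∨ z ∈ K (E₂ \ s₂)) ∧ (z ∈ K (E₁ \ s₁) ∨ z ∈ K s₂)) := by
          rintro ⟨h1 | h1, h2 | h2⟩
          · exact hc ⟨h1, h2⟩
          · exact hz1 h2
          · exact hz2 h1
          · exact hz2 h1
        rw [if_pos c1, if_pos c2, if_pos hc, if_pos hc, if_pos hc,
          Pga s₁ s₂ hz1, Pga (E₁ \ s₁) (E₂ \ s₂) hz2, Pga s₁ (E₂ \ s₂) hz2, Pga (E₁ \ s₁) s₂ hz1]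
        ring
    have hsum : I s₂ + I (E₂ \ s₂) =
        ∑ s₁ ∈ E₁.powerset, (if ¬ (z ∈ K s₁ ∧ z ∈ K (E₁ \ s₁)) then
            (f (gl s₂ (K s₁)) - f (gl s₂ (K (E₁ \ s₁)))) * (g (gl (E₂ \ s₂) (K s₁)) - g (gl (E₂ \ s₂) (K (E₁ \ s₁)))) else 0) +
        ∑ s₁ ∈ E₁.powerset, (if ¬ (z ∈ K s₁ ∧ z ∈ K (E₁ \ s₁)) then
            (f (gl (E₂ \ s₂) (K s₁)) - f (gl (E₂ \ s₂) (K (E₁ \ s₁)))) * (g (gl s₂ (K s₁)) - g (gl s₂ (K (E₁ \ s₁)))) else 0) +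
        ∑ s₁ ∈ E₁.powerset, (if ¬ (z ∈ K s₁ ∧ z ∈ K (E₁ \ s₁)) then
            ((f (gl s₂ (K s₁)) - f (gl (E₂ \ s₂) (K s₁))) * (g (gl s₂ (K s₁)) - g (gl (E₂ \ s₂) (K s₁))) +
             (f (gl s₂ (K (E₁ \ s₁))) - f (gl (E₂ \ s₂) (K (E₁ \ s₁)))) * (g (gl s₂ (K (E₁ \ s₁))) - g (gl (E₂ \ s₂) (K (E₁ \ s₁))))) else 0) := by
      simp only [hI]
      rw [← Finset.sum_add_distrib, ← Finset.sum_add_distrib, ← Finset.sum_add_distrib]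
      exact Finset.sum_congr rfl hpt
    rw [hsum]
    exact add_nonneg (add_nonneg hA hB) hC
  -- split the outer sum: wall colourings of `E₂` versus the rest
  rw [← Finset.sum_filter_add_sum_filter_not E₂.powerset (fun s₂ => z ∉ K s₂ ∧ z ∉ K (E₂ \ s₂)) I]
  apply add_nonneg
  · -- wall colourings: pair `s₂` with `E₂ \ s₂`
    set P : Finset ι → Prop := fun s₂ => z ∉ K s₂ ∧ z ∉ K (E₂ \ s₂) with hP
    have hPc : ∀ s₂ ∈ E₂.powerset, P (E₂ \ s₂) ↔ P s₂ := by
      intro s₂ hs₂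
      simp only [hP, Finset.sdiff_sdiff_eq_self (Finset.mem_powerset.mp hs₂)]
      tauto
    have hswap : ∑ s₂ ∈ E₂.powerset.filter P, I s₂ = ∑ s₂ ∈ E₂.powerset.filter P, I (E₂ \ s₂) := by
      rw [Finset.sum_filter, Finset.sum_filter]
      rw [← sum_powerset_sdiff E₂ (fun t => if P t then I t else 0)]
      refine Finset.sum_congr rfl fun s₂ hs₂ => ?_
      rw [if_congr (hPc s₂ hs₂) rfl rfl]
    have htwice : 2 * ∑ s₂ ∈ E₂.powerset.filter P, I s₂ = ∑ s₂ ∈ E₂.powerset.filter P, (I s₂ + I (E₂ \ s₂)) := by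
      rw [two_mul, Finset.sum_add_distrib, ← hswap]
    have hnn : 0 ≤ ∑ s₂ ∈ E₂.powerset.filter P, (I s₂ + I (E₂ \ s₂)) := by
      refine Finset.sum_nonneg fun s₂ hs₂ => ?_
      obtain ⟨hs₂E, hPs⟩ := Finset.mem_filter.mp hs₂
      exact block00 s₂ (Finset.mem_powerset.mp hs₂E) hPs.1 hPs.2
    have : 0 ≤ 2 * ∑ s₂ ∈ E₂.powerset.filter P, I s₂ := by rw [htwice]; exact hnn
    linarith
  · -- the other colourings of `E₂`: each inner sum is nonnegative
    refine Finset.sum_nonneg fun s₂ hs₂ => ?_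
    obtain ⟨hs₂E, hnot⟩ := Finset.mem_filter.mp hs₂
    have hs₂' := Finset.mem_powerset.mp hs₂E
    by_cases hz1 : z ∈ K s₂ <;> by_cases hz2 : z ∈ K (E₂ \ s₂)
    · rw [block11 s₂ hz1 hz2]
    · exact block10 s₂ hs₂' hz1 hz2
    · exact block01 s₂ hs₂' hz1 hz2
    · exact absurd ⟨hz1, hz2⟩ hnot

end Coefficientwise

end Summit.CriticalPhenomena.PercolationContinuityZ3.Theorems
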